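import Summits.CriticalPhenomena.PercolationContinuityZ3.Theorems.PercNearOneGluingNoHeavyLowerTailKnQuestion8PocketAssembly
import Summits.CriticalPhenomena.PercolationContinuityZ3.Theorems.PercNearOneGluingNoHeavyLowerTailQ7PsiZDual
import HarnessLib

/-!
# Kozma–Nitzan's Question 8 / MC-D for three relays — the weak-relay part (Z*D) of the pocket certificate is DUAL to
# observer halves for the SET cluster `C_x ∪ C_o`; (41) at three relays from pocket covariance comparisons ALONE

Support file (`--supports stmt-CriticalPhenomena-4575`, closed), prover `prim-lf-2` (gen 17).  No definitions, no named facts,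
no sorries; standard axioms.  Memo `prim-lf-2/POCKET-SETDUAL-gen17.md`; companions `…KnQuestion8PocketAssembly.lean`
(`PocketCert.block41_three_of_pcov`: (41)@3 ⟸ PCOV_x ∧ PCOV_y ∧ (Z*D)), `…Q7PsiZDual.lean` (`Q7Psi.zhalf_of_xhalf`: the
non-pocket duality through `σ(C_x)`).

In the tree's (GΨ₃) certificate the weak-relay part (Z*) follows from the observer halves by conditioning on the owner's
cluster `C_x` (`Q7Psi.zhalf_of_xhalf`).  For the POCKET-designated certificate (Question 8: pocket `P = {C_o ∈ 𝒟}`) this fails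
verbatim because `P ∩ {x ↮ z}` is not `σ(C_x)`-measurable (prim-lf-2 gen 16, POCKET-CERT §0(6)).  It IS measurable for the
exploration of the cluster of the SET `S = {x, o}`, and given that exploration the cluster of `z ∉ C_S` is fresh percolation
off the pairs meeting `C_x ∪ C_o` (van den Berg–Häggström–Kahn Lemma 2.4 for vertex sets, tree `BHK2006.set_sum_cond_cluster`):
* `PocketCert.tower_setCl` — `∫_{S↮a, C_S ∈ 𝒮} F(C a) = ∫_{S↮a, C_S ∈ 𝒮} E[F(C a) | C_S]`, the conditional mean being the fresh
  expectation on `G` minus the pairs meeting `S ∪ V(C_S)` (any vertex set `S`);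
* `PocketCert.zhalf_of_setHalf` — **duality**: if for every monotone `G`
  `λ ∫_{P ∩ {x↮z}} G(C x ∪ C o) ≤ ∫_{W1} G(C x) + t ∫_{W3} G(C x)` (the set-cluster observer half (P1*D⁺);
  `W1 = {x↔o, x↮y, x↮z}`, `W3 = {x↔o, x↔y, x↮z}`), then for every monotone `F`
  `∫_{W1} F(C z) + t ∫_{W3} F(C z) ≤ λ ∫_{P ∩ {x↮z}} F(C z)`;
* `PocketCert.zpart_of_setHalves` — (Z*D) from the two set-cluster halves;
Sequels: `…KnQuestion8PocketSetAttach.lean` (the attachment piece (BHK-D⁺) `μ(W1)·∫_{P∩E1} G(C x ∪ C o) ≤ μ(P∩E1)·∫_{W1} G(C x)`,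
proved for every pocket family) and `…KnQuestion8PocketSetAssembly.lean` ((41) at three relays from the pocket covariance
comparisons PCOV / PCOV⁺ alone — the hypothesis (Z*D) of `block41_three_of_pcov` is gone).  prim-lf-2 gen 17 census: (P1*D⁺) and
(P2*D⁺) at the certificate point `(t_D, λ_D, μ_D)` hold in 1 196 / 1 196 exact instances (n ≤ 8; pockets Q8 / Q8+spectator /
size-truncated / Q9), so (Z*D) is no longer an independent input.
[cite: VandenbergHaggstromKahn2005, §2.1 Lemma 2.4 (p. 10), Thm. 2.1 (p. 9)] [cite: KozmaNitzan2024, Questions 8–9 (§5.5 p. 36), display (41), §5.1 (pp. 31–32)]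
-/

namespace Summit.CriticalPhenomena.PercolationContinuityZ3.Theorems

open MeasureTheory Set Literature.Probability.LatticeModels Literature.Probability.Percolation
open scoped Classical
open KNPreFKG BHK2006 DecisionTree

noncomputable section

namespace PocketCert

variable {V : Type*} [Fintype V]

omit [Fintype V] in
/-- Reachability from a vertex of `S` is read off the edge cluster `C_S` of the set `S`.
[cite: VandenbergHaggstromKahn2005, §2.1 p. 9 (definition of `C_S`)] -/
theorem reachable_iff_of_setCl_eq {S : Set V} {s : V} (hs : s ∈ S) {ω ω' : BondConfig V}
    (h : setCl ω S = setCl ω' S) (v : V) :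
    (openGraph ω).Reachable s v ↔ (openGraph ω').Reachable s v := by
  rw [KNSep.reachable_iff_cluster ω S hs v, KNSep.reachable_iff_cluster ω' S hs v]
  change (openGraph (setCl ω S)).Reachable s v ↔ (openGraph (setCl ω' S)).Reachable s v
  rw [h]

omit [Fintype V] in
/-- The open vertex cluster of a vertex of `S` is read off `C_S`. [cite: VandenbergHaggstromKahn2005, §2.1 p. 9] -/
theorem openCluster_eq_of_setCl_eq {S : Set V} {s : V} (hs : s ∈ S) {ω ω' : BondConfig V}
    (h : setCl ω S = setCl ω' S) : openCluster ω s = openCluster ω' s := by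
  ext v
  exact reachable_iff_of_setCl_eq hs h v

/-- **Tower property along the exploration of `C_S` on `{S ↮ a}` (vdBHK Lemma 2.4 for a vertex SET `S`).**  For any `F` on
vertex sets and any family `𝒮` of edge sets:
`∫_{S↮a, C_S ∈ 𝒮} F(C(a)) dμ = ∫_{S↮a, C_S ∈ 𝒮} (∫ F(C_a(η ∖ B_S(C_S))) dμ(η)) dμ`, `B_S(W)` the pairs meeting `S ∪ V(W)` —
given `C_S` (inside `{S ↮ a}`) the cluster of `a` is the cluster of `a` for fresh percolation on `G` minus those pairs.
[cite: VandenbergHaggstromKahn2005, §2.1 Lemma 2.4 (p. 10)] -/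
theorem tower_setCl (w : Sym2 V → unitInterval) (S : Set V) (a : V) (F : Set V → ℝ) (𝒮 : Set (Set (Sym2 V))) :
    ∫ ω in {ω : BondConfig V | ∀ s ∈ S, ¬ (openGraph ω).Reachable s a} ∩ {ω | setCl ω S ∈ 𝒮},
        F (openCluster ω a) ∂(prodBernoulli w) =
      ∫ ω in {ω : BondConfig V | ∀ s ∈ S, ¬ (openGraph ω).Reachable s a} ∩ {ω | setCl ω S ∈ 𝒮},
        (∫ η, F (openCluster (η \ barOf S (setCl ω S)) a) ∂(prodBernoulli w)) ∂(prodBernoulli w) := by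
  classical
  set μ := prodBernoulli w with hμ
  set D : Set (BondConfig V) := {ω : BondConfig V | ∀ s ∈ S, ¬ (openGraph ω).Reachable s a} with hD
  have hDiff : ∀ ω : BondConfig V, ω ∈ D ↔ ∀ s ∈ S, ∀ t ∈ ({a} : Set V), ¬ (openGraph ω).Reachable s t := by
    intro ω
    simp only [hD, mem_setOf_eq, mem_singleton_iff, forall_eq]
  have hm : ∑ ω : Set (Sym2 V), weight (fun e => (w e : ℝ)) ω = 1 := by
    have h1 := integral_prodBernoulli_eq_sum w fun _ => (1 : ℝ)
    simp only [integral_const, probReal_univ, smul_eq_mul, mul_one] at h1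
    exact h1.symm
  have key := set_sum_cond_cluster (fun e => (w e : ℝ)) hm S ({a} : Set V)
    (fun K L => ind 𝒮 K * F {z | z = a ∨ ∃ e ∈ L, z ∈ e}) hDiff
  simp only [setCl_singleton] at key
  have hvert : ∀ η : BondConfig V, F {z | z = a ∨ ∃ e ∈ openEdgeCluster η a, z ∈ e} = F (openCluster η a) :=
    fun η => clusterFun_openEdgeCluster F η a
  simp only [hvert] at key
  rw [← integral_indicator (MeasurableSet.of_discrete), ← integral_indicator (MeasurableSet.of_discrete),
    integral_prodBernoulli_eq_sum, integral_prodBernoulli_eq_sum]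
  have hL : ∀ ω : BondConfig V, (D ∩ {ω | setCl ω S ∈ 𝒮}).indicator (fun ω => F (openCluster ω a)) ω =
      ind 𝒮 (setCl ω S) * F (openCluster ω a) * ind D ω := by
    intro ω
    by_cases h1 : ω ∈ D
    · by_cases h2 : setCl ω S ∈ 𝒮
      · rw [indicator_of_mem (show ω ∈ D ∩ {ω | setCl ω S ∈ 𝒮} from ⟨h1, h2⟩), ind_of_mem h1, ind_of_mem h2]; ring
      · rw [indicator_of_notMem (fun h => h2 h.2), ind_of_not_mem h2]; ring
    · rw [indicator_of_notMem (fun h => h1 h.1), ind_of_not_mem h1]; ring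
  have hR : ∀ ω : BondConfig V, (D ∩ {ω | setCl ω S ∈ 𝒮}).indicator
      (fun ω => ∫ η, F (openCluster (η \ barOf S (setCl ω S)) a) ∂μ) ω =
      (∑ η : Set (Sym2 V), weight (fun e => (w e : ℝ)) η *
        (ind 𝒮 (setCl ω S) * F (openCluster (η \ barOf S (setCl ω S)) a))) * ind D ω := by
    intro ω
    have hint : ∫ η, F (openCluster (η \ barOf S (setCl ω S)) a) ∂μ =
        ∑ η : Set (Sym2 V), weight (fun e => (w e : ℝ)) η * F (openCluster (η \ barOf S (setCl ω S)) a) :=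
      integral_prodBernoulli_eq_sum w _
    by_cases h1 : ω ∈ D
    · by_cases h2 : setCl ω S ∈ 𝒮
      · rw [indicator_of_mem (show ω ∈ D ∩ {ω | setCl ω S ∈ 𝒮} from ⟨h1, h2⟩), ind_of_mem h1, ind_of_mem h2, hint]
        simp only [one_mul, mul_one]
      · rw [indicator_of_notMem (fun h => h2 h.2), ind_of_not_mem h2]
        simp only [zero_mul, mul_zero, Finset.sum_const_zero]
    · rw [indicator_of_notMem (fun h => h1 h.1), ind_of_not_mem h1]; ring
  simp only [hL, hR]
  exact key

omit [Fintype V] in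
/-- For `S = {x, o}` the pairs meeting `S ∪ V(C_S)` are the pairs meeting `C x ∪ C o`.
[cite: VandenbergHaggstromKahn2005, §1 p. 8 (definition of `W̄`)] -/
theorem barOf_setCl_pair (ω : BondConfig V) (x o : V) :
    barOf ({x, o} : Set V) (setCl ω {x, o}) = {e : Sym2 V | ∃ v ∈ e, v ∈ openCluster ω x ∪ openCluster ω o} := by
  rw [barOf_setCl_eq]
  ext e
  simp only [mem_setOf_eq, mem_insert_iff, mem_singleton_iff, exists_eq_or_imp, exists_eq_left, mem_union, openCluster]

/-- **Duality through the set cluster: the `x`-half of (Z*D) from the set-cluster observer half (P1*D⁺).**  `𝒟` a family of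
vertex sets none of which contains `z`, `P = {C_o ∈ 𝒟}`.  If for every monotone `G`
`λ ∫_{P ∩ {x↮z}} G(C x ∪ C o) ≤ ∫_{x↔o ∩ x↮y ∩ x↮z} G(C x) + t ∫_{x↔o ∩ x↔y ∩ x↮z} G(C x)`, then for every monotone `F`
`∫_{x↔o ∩ x↮y ∩ x↮z} F(C z) + t ∫_{x↔o ∩ x↔y ∩ x↮z} F(C z) ≤ λ ∫_{P ∩ {x↮z}} F(C z)`.
Proof: on the two observer worlds condition on `C_x` (`Q7Psi.tower_weak`), on the pocket event condition on the cluster of the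
set `{x, o}` (`tower_setCl`; `P ∩ {x↮z}` is determined by it and lies in `{{x,o} ↮ z}`); the conditional mean of `F(C z)` is
the decreasing function `k(T) = E F(C_z(η ∖ pairs meeting T))` at `T = C x` resp. `T = C x ∪ C o`.
[cite: VandenbergHaggstromKahn2005, §2.1 Lemma 2.4 (p. 10)] [cite: KozmaNitzan2024, Questions 8–9 (§5.5 p. 36), §5.1 (pp. 31–32)] -/
theorem zhalf_of_setHalf (w : Sym2 V → unitInterval) (o x y z : V) (𝒟 : Set (Set V)) (hz : ∀ W ∈ 𝒟, z ∉ W)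
    (F : Set V → ℝ) (hF : ∀ S T : Set V, S ⊆ T → F S ≤ F T) (t lam : ℝ)
    (hP1 : ∀ G : Set V → ℝ, (∀ S T : Set V, S ⊆ T → G S ≤ G T) →
      lam * ∫ ω in {ω : BondConfig V | openCluster ω o ∈ 𝒟} ∩ {ω | ¬ (openGraph ω).Reachable x z},
          G (openCluster ω x ∪ openCluster ω o) ∂(prodBernoulli w) ≤
        (∫ ω in openConn x o ∩ {ω | ¬ (openGraph ω).Reachable x y} ∩ {ω | ¬ (openGraph ω).Reachable x z},
            G (openCluster ω x) ∂(prodBernoulli w)) +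
          t * ∫ ω in openConn x o ∩ openConn x y ∩ {ω | ¬ (openGraph ω).Reachable x z},
            G (openCluster ω x) ∂(prodBernoulli w)) :
    (∫ ω in openConn x o ∩ {ω | ¬ (openGraph ω).Reachable x y} ∩ {ω | ¬ (openGraph ω).Reachable x z},
        F (openCluster ω z) ∂(prodBernoulli w)) +
      t * ∫ ω in openConn x o ∩ openConn x y ∩ {ω | ¬ (openGraph ω).Reachable x z},
        F (openCluster ω z) ∂(prodBernoulli w) ≤
      lam * ∫ ω in {ω : BondConfig V | openCluster ω o ∈ 𝒟} ∩ {ω | ¬ (openGraph ω).Reachable x z},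
        F (openCluster ω z) ∂(prodBernoulli w) := by
  classical
  set μ := prodBernoulli w with hμ
  set D : Set (BondConfig V) := {ω | ¬ (openGraph ω).Reachable x z} with hD
  set P : Set (BondConfig V) := {ω : BondConfig V | openCluster ω o ∈ 𝒟} with hP
  -- the conditional mean of `F(C z)` given the deleted vertex set, with a sign
  set G : Set V → ℝ := fun T => - ∫ η, F (openCluster (η \ {e : Sym2 V | ∃ v ∈ e, v ∈ T}) z) ∂μ with hG
  have hGmono : ∀ S T : Set V, S ⊆ T → G S ≤ G T := fun S T hST =>
    neg_le_neg (Q7Psi.condMean_antitone w z F hF S T hST)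
  have key := hP1 G hGmono
  -- the two observer worlds as `σ(C_x)`-events inside `D`
  set 𝒮₁ : Set (Set (Sym2 V)) := {K | (o = x ∨ ∃ e ∈ K, o ∈ e) ∧ ¬ (y = x ∨ ∃ e ∈ K, y ∈ e)} with h𝒮₁
  set 𝒮₂ : Set (Set (Sym2 V)) := {K | (o = x ∨ ∃ e ∈ K, o ∈ e) ∧ (y = x ∨ ∃ e ∈ K, y ∈ e)} with h𝒮₂
  have hE1 : openConn x o ∩ {ω | ¬ (openGraph ω).Reachable x y} ∩ D = D ∩ {ω | openEdgeCluster ω x ∈ 𝒮₁} := by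
    ext ω
    simp only [mem_inter_iff, openConn, mem_setOf_eq, h𝒮₁, reachable_iff_exists_mem_openEdgeCluster ω x o,
      reachable_iff_exists_mem_openEdgeCluster ω x y]
    tauto
  have hE2 : openConn x o ∩ openConn x y ∩ D = D ∩ {ω | openEdgeCluster ω x ∈ 𝒮₂} := by
    ext ω
    simp only [mem_inter_iff, openConn, mem_setOf_eq, h𝒮₂, reachable_iff_exists_mem_openEdgeCluster ω x o,
      reachable_iff_exists_mem_openEdgeCluster ω x y]
    tauto
  have hTow : ∀ 𝒮 : Set (Set (Sym2 V)),
      ∫ ω in D ∩ {ω | openEdgeCluster ω x ∈ 𝒮}, F (openCluster ω z) ∂μ =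
        - ∫ ω in D ∩ {ω | openEdgeCluster ω x ∈ 𝒮}, G (openCluster ω x) ∂μ := by
    intro 𝒮
    rw [hμ, hD, Q7Psi.tower_weak w x z F 𝒮, ← integral_neg]
    refine setIntegral_congr_fun MeasurableSet.of_discrete fun ω _ => ?_
    simp only [hG, neg_neg, hμ]
  have i1 : ∫ ω in openConn x o ∩ {ω | ¬ (openGraph ω).Reachable x y} ∩ D, F (openCluster ω z) ∂μ =
      - ∫ ω in openConn x o ∩ {ω | ¬ (openGraph ω).Reachable x y} ∩ D, G (openCluster ω x) ∂μ := by
    rw [hE1]; exact hTow 𝒮₁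
  have i2 : ∫ ω in openConn x o ∩ openConn x y ∩ D, F (openCluster ω z) ∂μ =
      - ∫ ω in openConn x o ∩ openConn x y ∩ D, G (openCluster ω x) ∂μ := by
    rw [hE2]; exact hTow 𝒮₂
  -- the pocket event as an event of the cluster of the SET `{x, o}` inside `{{x,o} ↮ z}`
  set S : Set V := {x, o} with hS
  have hxS : x ∈ S := by simp [hS]
  have hoS : o ∈ S := by simp [hS]
  set DS : Set (BondConfig V) := {ω : BondConfig V | ∀ s ∈ S, ¬ (openGraph ω).Reachable s z} with hDS
  set 𝒮₀ : Set (Set (Sym2 V)) := {K | ∃ ω' : BondConfig V, ω' ∈ P ∩ D ∧ setCl ω' S = K} with h𝒮₀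
  have hE0 : P ∩ D = DS ∩ {ω | setCl ω S ∈ 𝒮₀} := by
    ext ω
    constructor
    · rintro ⟨hωP, hωD⟩
      refine ⟨?_, ⟨ω, ⟨hωP, hωD⟩, rfl⟩⟩
      simp only [hDS, hS, mem_setOf_eq, mem_insert_iff, mem_singleton_iff, forall_eq_or_imp, forall_eq]
      exact ⟨hωD, fun hoz => hz _ hωP hoz⟩
    · rintro ⟨-, ⟨ω', ⟨hω'P, hω'D⟩, hK⟩⟩
      refine ⟨?_, ?_⟩
      · change openCluster ω o ∈ 𝒟
        rw [← openCluster_eq_of_setCl_eq hoS hK]; exact hω'P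
      · change ¬ (openGraph ω).Reachable x z
        rw [← reachable_iff_of_setCl_eq hxS hK z]; exact hω'D
  have i0 : ∫ ω in P ∩ D, F (openCluster ω z) ∂μ = - ∫ ω in P ∩ D, G (openCluster ω x ∪ openCluster ω o) ∂μ := by
    rw [hE0, hμ, hDS, tower_setCl w S z F 𝒮₀, ← integral_neg]
    refine setIntegral_congr_fun MeasurableSet.of_discrete fun ω _ => ?_
    simp only [hG, neg_neg, hS, barOf_setCl_pair, hμ]
  rw [i0, i1, i2]
  linarith [key]

/-- **(Z*D) from the two set-cluster observer halves.**  `P = {C_o ∈ 𝒟}` (`z` in no member of `𝒟`),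
`J' = (o↔x ∪ o↔y) ∩ {o↮z}`: if (P1*D⁺) holds for every monotone `G` (split `t`, multiplier `λ`) and (P2*D⁺) for every monotone
`G` (split `1 − t`, multiplier `μ`), then `∫_{J'} F(C z) ≤ λ ∫_{P ∩ {x↮z}} F(C z) + μ ∫_{P ∩ {y↮z}} F(C z)` for every monotone `F`
— the hypothesis `hZ` of `block41_three_of_pocketCert` / `gpsi_three_pocket_of_dom`.
[cite: KozmaNitzan2024, Questions 8–9 (§5.5 p. 36), §5.1 (pp. 31–32)] [cite: VandenbergHaggstromKahn2005, §2.1 Lemma 2.4 (p. 10)] -/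
theorem zpart_of_setHalves (w : Sym2 V → unitInterval) (o x y z : V) (𝒟 : Set (Set V)) (hz : ∀ W ∈ 𝒟, z ∉ W)
    (F : Set V → ℝ) (hF : ∀ S T : Set V, S ⊆ T → F S ≤ F T) (t lam mu : ℝ)
    (hP1 : ∀ G : Set V → ℝ, (∀ S T : Set V, S ⊆ T → G S ≤ G T) →
      lam * ∫ ω in {ω : BondConfig V | openCluster ω o ∈ 𝒟} ∩ {ω | ¬ (openGraph ω).Reachable x z},
          G (openCluster ω x ∪ openCluster ω o) ∂(prodBernoulli w) ≤
        (∫ ω in openConn x o ∩ {ω | ¬ (openGraph ω).Reachable x y} ∩ {ω | ¬ (openGraph ω).Reachable x z},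
            G (openCluster ω x) ∂(prodBernoulli w)) +
          t * ∫ ω in openConn x o ∩ openConn x y ∩ {ω | ¬ (openGraph ω).Reachable x z},
            G (openCluster ω x) ∂(prodBernoulli w))
    (hP2 : ∀ G : Set V → ℝ, (∀ S T : Set V, S ⊆ T → G S ≤ G T) →
      mu * ∫ ω in {ω : BondConfig V | openCluster ω o ∈ 𝒟} ∩ {ω | ¬ (openGraph ω).Reachable y z},
          G (openCluster ω y ∪ openCluster ω o) ∂(prodBernoulli w) ≤
        (∫ ω in openConn y o ∩ {ω | ¬ (openGraph ω).Reachable y x} ∩ {ω | ¬ (openGraph ω).Reachable y z},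
            G (openCluster ω y) ∂(prodBernoulli w)) +
          (1 - t) * ∫ ω in openConn y o ∩ openConn y x ∩ {ω | ¬ (openGraph ω).Reachable y z},
            G (openCluster ω y) ∂(prodBernoulli w)) :
    ∫ ω in (openConn o x ∪ openConn o y) ∩ {ω | ¬ (openGraph ω).Reachable o z},
        F (openCluster ω z) ∂(prodBernoulli w) ≤
      lam * (∫ ω in {ω : BondConfig V | openCluster ω o ∈ 𝒟} ∩ {ω | ¬ (openGraph ω).Reachable x z},
          F (openCluster ω z) ∂(prodBernoulli w)) +
        mu * (∫ ω in {ω : BondConfig V | openCluster ω o ∈ 𝒟} ∩ {ω | ¬ (openGraph ω).Reachable y z},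
          F (openCluster ω z) ∂(prodBernoulli w)) := by
  classical
  set μ' := prodBernoulli w with hμ
  set S1 : Set (BondConfig V) :=
    openConn x o ∩ {ω | ¬ (openGraph ω).Reachable x y} ∩ {ω | ¬ (openGraph ω).Reachable x z} with hS1
  set S2 : Set (BondConfig V) :=
    openConn y o ∩ {ω | ¬ (openGraph ω).Reachable y x} ∩ {ω | ¬ (openGraph ω).Reachable y z} with hS2
  set S3 : Set (BondConfig V) := openConn x o ∩ openConn x y ∩ {ω | ¬ (openGraph ω).Reachable x z} with hS3
  set S3' : Set (BondConfig V) := openConn y o ∩ openConn y x ∩ {ω | ¬ (openGraph ω).Reachable y z} with hS3'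
  set J' : Set (BondConfig V) := (openConn o x ∪ openConn o y) ∩ {ω | ¬ (openGraph ω).Reachable o z} with hJ'
  have hmeas : ∀ S : Set (BondConfig V), MeasurableSet S := fun _ => MeasurableSet.of_discrete
  have hint : ∀ (g : BondConfig V → ℝ) (S : Set (BondConfig V)), IntegrableOn g S μ' :=
    fun g S => (Integrable.of_finite).integrableOn
  have hx := zhalf_of_setHalf w o x y z 𝒟 hz F hF t lam hP1
  have hy := zhalf_of_setHalf w o y x z 𝒟 hz F hF (1 - t) mu hP2
  change (∫ ω in S1, F (openCluster ω z) ∂μ') + t * ∫ ω in S3, F (openCluster ω z) ∂μ' ≤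
    lam * ∫ ω in {ω : BondConfig V | openCluster ω o ∈ 𝒟} ∩ {ω | ¬ (openGraph ω).Reachable x z},
      F (openCluster ω z) ∂μ' at hx
  change (∫ ω in S2, F (openCluster ω z) ∂μ') + (1 - t) * ∫ ω in S3', F (openCluster ω z) ∂μ' ≤
    mu * ∫ ω in {ω : BondConfig V | openCluster ω o ∈ 𝒟} ∩ {ω | ¬ (openGraph ω).Reachable y z},
      F (openCluster ω z) ∂μ' at hy
  have h33 : S3 = S3' := by
    ext ω
    simp only [hS3, hS3', mem_inter_iff, mem_setOf_eq, openConn]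
    constructor
    · rintro ⟨⟨hxo, hxy⟩, hxz⟩
      exact ⟨⟨hxy.symm.trans hxo, hxy.symm⟩, fun hyz => hxz (hxy.trans hyz)⟩
    · rintro ⟨⟨hyo, hyx⟩, hyz⟩
      exact ⟨⟨hyx.symm.trans hyo, hyx.symm⟩, fun hxz => hyz (hyx.trans hxz)⟩
  have hJeq : J' = (S1 ∪ S2) ∪ S3 := by
    ext ω
    simp only [hJ', hS1, hS2, hS3, mem_inter_iff, mem_union, mem_setOf_eq, openConn]
    constructor
    · rintro ⟨hJ, hoz⟩
      by_cases hox : (openGraph ω).Reachable o x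
      · by_cases hxy : (openGraph ω).Reachable x y
        · exact Or.inr ⟨⟨hox.symm, hxy⟩, fun hxz => hoz (hox.trans hxz)⟩
        · exact Or.inl (Or.inl ⟨⟨hox.symm, hxy⟩, fun hxz => hoz (hox.trans hxz)⟩)
      · have hoy : (openGraph ω).Reachable o y := by
          rcases hJ with h | h
          · exact absurd h hox
          · exact h
        refine Or.inl (Or.inr ⟨⟨hoy.symm, fun hyx => hox (hoy.trans hyx)⟩, fun hyz => hoz (hoy.trans hyz)⟩)
    · rintro ((⟨⟨hxo, _⟩, hxz⟩ | ⟨⟨hyo, _⟩, hyz⟩) | ⟨⟨hxo, _⟩, hxz⟩)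
      · exact ⟨Or.inl hxo.symm, fun hoz => hxz (hxo.trans hoz)⟩
      · exact ⟨Or.inr hyo.symm, fun hoz => hyz (hyo.trans hoz)⟩
      · exact ⟨Or.inl hxo.symm, fun hoz => hxz (hxo.trans hoz)⟩
  have hd12 : Disjoint S1 S2 := by
    rw [Set.disjoint_left]
    rintro ω ⟨⟨hxo, hxy⟩, _⟩ ⟨⟨hyo, _⟩, _⟩
    exact hxy (SimpleGraph.Reachable.trans hxo (SimpleGraph.Reachable.symm hyo))
  have hd123 : Disjoint (S1 ∪ S2) S3 := by
    rw [Set.disjoint_left]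
    rintro ω (⟨⟨_, hxy⟩, _⟩ | ⟨⟨_, hyx⟩, _⟩) ⟨⟨_, hxy'⟩, _⟩
    · exact hxy hxy'
    · exact hyx (SimpleGraph.Reachable.symm hxy')
  have hsplit : ∫ ω in J', F (openCluster ω z) ∂μ' =
      ∫ ω in S1, F (openCluster ω z) ∂μ' + ∫ ω in S2, F (openCluster ω z) ∂μ' +
        ∫ ω in S3, F (openCluster ω z) ∂μ' := by
    rw [hJeq, setIntegral_union hd123 (hmeas _) (hint _ _) (hint _ _),
      setIntegral_union hd12 (hmeas _) (hint _ _) (hint _ _)]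
  have e3 : ∫ ω in S3, F (openCluster ω z) ∂μ' =
      t * ∫ ω in S3, F (openCluster ω z) ∂μ' + (1 - t) * ∫ ω in S3', F (openCluster ω z) ∂μ' := by
    rw [← h33]; ring
  rw [hsplit, e3]
  linarith

end PocketCert

end

end Summit.CriticalPhenomena.PercolationContinuityZ3.Theorems
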